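import Summits.AtomisticToContinuum.FouriersLaw.Theorems.BondHeatUncertaintyExtensiveSnapshotIrreversibilityEnergyWindowSkeletonLaw
import Mathlib.Probability.Distributions.Gaussian.HasGaussianLaw.Independence
import HarnessLib

/-!
# Bond–heat uncertainty window, part U-f: moments of LINEAR functionals of the skeleton

Cell `decomp-a2c`, lineage crux `ExtensiveSnapshotIrreversibility` (K_fix half, leaf S3
`KernelTemperatureLipschitz`), HARMONIC CALIBRATION of (SWM) `SkeletonWeightMoments` (part R),
auxiliary file.  GENERIC: imports only part S file 1 (`…EnergyWindowSkeletonLaw`: `skelVar`,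
`skelGauss`, `map_pairSkel_wienerPair`) and Mathlib.

For the harmonic chain the regularised skeleton weights of part R are LINEAR functionals
`x ↦ Σ_j x_j U_j` of the level-`m` skeleton (part U-d).  Here we compute their moments exactly:

* §1 under the product Gaussian `N(0, v)^{⊗ι}` the functional `f ↦ Σ_i c_i f_i` is independent-sum
  Gaussian (Mathlib `iIndepFun_pi`, `iIndepFun.hasGaussianLaw_fun_sum`), centred, of variance
  `v Σ_i c_i²` (Bienaymé, Mathlib `variance_sum_pi`), hence has law `N(0, v Σ c_i²)`
  (`map_linear_piGaussian`); the `q`-th absolute moment of `N(0, w)` is `w^{q/2} M_q` with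
  `M_q = E|Z|^q < ∞`, `Z ∼ N(0,1)` (`lintegral_abs_rpow_gaussianReal`, `gaussAbsMoment_lt_top`);
* §2 transported to the skeleton Gaussian `skelGauss m` (coordinates i.i.d. `N(0, 2^{-m})`, Mathlib
  `measurePreserving_sumPiEquivProdPi`) and to the two-bath Wiener measure (part S
  `map_pairSkel_wienerPair`): `E |Σ_j Ξ_j U_j|^q = (2^{-m} Σ_j U_j²)^{q/2} M_q`
  (`lintegral_abs_linear_rpow_skelGauss`, `lintegral_abs_linear_rpow_wienerPair`).

No new instance / notation; no proof holes.  References: D. Nualart, *The Malliavin Calculus and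
Related Topics* (2006), §1.1.1 (Wiener chaos of order one). [folklore]
-/

noncomputable section

namespace Summit.AtomisticToContinuum.FouriersLaw.Theorems.ExtensiveSnapshotIrreversibility.EnergyWindow

open MeasureTheory ProbabilityTheory Filter Topology Set
open scoped ENNReal NNReal
open Literature.Probability.Process Literature.MathematicalPhysics.KineticTheory.HeatConduction

/-! ## 1. Linear functionals of a product Gaussian -/

section PiGaussian

variable {ι : Type} [Fintype ι] (v : ℝ≥0) (c : ι → ℝ)

/-- Each coordinate of `N(0,v)^{⊗ι}` has law `N(0,v)`. [folklore] -/
theorem map_eval_piGaussian (i : ι) :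
    (Measure.pi fun _ : ι => gaussianReal 0 v).map (fun f => f i) = gaussianReal 0 v :=
  (measurePreserving_eval (fun _ : ι => gaussianReal 0 v) i).map_eq

/-- `f ↦ c_i f_i` is Gaussian under `N(0,v)^{⊗ι}`. [folklore] -/
theorem hasGaussianLaw_const_mul_eval (i : ι) :
    HasGaussianLaw (fun f : ι → ℝ => c i * f i) (Measure.pi fun _ : ι => gaussianReal 0 v) := by
  have h : IsGaussian ((Measure.pi fun _ : ι => gaussianReal 0 v).map (fun f => f i)) := by
    rw [map_eval_piGaussian]
    infer_instance
  exact (IsGaussian.hasGaussianLaw (P := Measure.pi fun _ : ι => gaussianReal 0 v)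
    (X := fun f : ι → ℝ => f i)).fun_smul (c i)

/-- **`f ↦ Σ_i c_i f_i` is Gaussian under `N(0,v)^{⊗ι}`** (independent Gaussian summands).
[folklore] -/
theorem hasGaussianLaw_linear_piGaussian :
    HasGaussianLaw (fun f : ι → ℝ => ∑ i, c i * f i) (Measure.pi fun _ : ι => gaussianReal 0 v) :=
  (iIndepFun_pi (μ := fun _ : ι => gaussianReal 0 v) (X := fun i x => c i * x)
      (fun i => (measurable_const_mul (c i)).aemeasurable)).hasGaussianLaw_fun_sum
    (fun i => hasGaussianLaw_const_mul_eval v c i)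

/-- `E[Σ_i c_i f_i] = 0`. [folklore] -/
theorem integral_linear_piGaussian :
    ∫ f, (∑ i, c i * f i) ∂(Measure.pi fun _ : ι => gaussianReal 0 v) = 0 := by
  rw [integral_finsetSum _ (fun i _ => (hasGaussianLaw_const_mul_eval v c i).integrable)]
  refine Finset.sum_eq_zero fun i _ => ?_
  rw [integral_const_mul, integral_eval (μ := fun _ : ι => gaussianReal 0 v),
    integral_id_gaussianReal, mul_zero]

/-- `Var[Σ_i c_i f_i] = (Σ_i c_i²) v` (Bienaymé). [folklore] -/
theorem variance_linear_piGaussian :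
    Var[fun f : ι → ℝ => ∑ i, c i * f i; Measure.pi fun _ : ι => gaussianReal 0 v] =
      (∑ i, c i ^ 2) * v := by
  have h : (fun f : ι → ℝ => ∑ i, c i * f i) = ∑ i, fun f : ι → ℝ => c i * f i := by
    ext f
    simp [Finset.sum_apply]
  rw [h, variance_sum_pi (X := fun i x => c i * x) (fun i => IsGaussian.memLp_two_id.const_mul _)]
  change ∑ i, Var[fun x ↦ c i * (id x); gaussianReal 0 v] = _
  simp_rw [variance_const_mul, variance_id_gaussianReal]
  rw [Finset.sum_mul]

/-- **The law of `Σ_i c_i f_i` under `N(0,v)^{⊗ι}` is `N(0, (Σ c_i²) v)`.** [folklore] -/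
theorem map_linear_piGaussian :
    (Measure.pi fun _ : ι => gaussianReal 0 v).map (fun f => ∑ i, c i * f i) =
      gaussianReal 0 (((∑ i, c i ^ 2) * v : ℝ).toNNReal) := by
  rw [(hasGaussianLaw_linear_piGaussian v c).map_eq_gaussianReal, integral_linear_piGaussian,
    variance_linear_piGaussian]

end PiGaussian

/-! ### Absolute moments of a centred real Gaussian -/

section AbsMoment

/-- `M_q = E |Z|^q`, `Z ∼ N(0,1)` (as a Lebesgue integral). [folklore] -/
def gaussAbsMoment (q : ℝ) : ℝ≥0∞ := ∫⁻ x, ENNReal.ofReal |x| ^ q ∂(gaussianReal 0 1)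

/-- `M_q < ∞` for `q > 0` (all Gaussian moments are finite). [folklore] -/
theorem gaussAbsMoment_lt_top {q : ℝ} (hq : 0 < q) : gaussAbsMoment q < ∞ := by
  have hmem := memLp_id_gaussianReal' (μ := 0) (v := 1) (ENNReal.ofReal q) ENNReal.ofReal_ne_top
  have h := lintegral_rpow_enorm_lt_top_of_eLpNorm_lt_top
    (fun h0 => absurd (ENNReal.ofReal_eq_zero.1 h0) (not_le.2 hq)) ENNReal.ofReal_ne_top
    hmem.eLpNorm_lt_top
  rw [ENNReal.toReal_ofReal hq.le] at h
  unfold gaussAbsMoment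
  convert h using 3 with x
  rw [id, Real.enorm_eq_ofReal_abs]

/-- The integrand `x ↦ |x|^q` (as `ℝ≥0∞`) is measurable. [folklore] -/
theorem measurable_ofReal_abs_rpow (q : ℝ) : Measurable fun x : ℝ => ENNReal.ofReal |x| ^ q :=
  (continuous_abs.measurable.ennreal_ofReal).pow_const q

/-- **`E|X|^q = w^{q/2} M_q` for `X ∼ N(0, w)`** (scaling `N(0,w) = √w · N(0,1)`). [folklore] -/
theorem lintegral_abs_rpow_gaussianReal (w : ℝ≥0) {q : ℝ} (hq : 0 ≤ q) :
    ∫⁻ x, ENNReal.ofReal |x| ^ q ∂(gaussianReal 0 w) =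
      ENNReal.ofReal (Real.sqrt w ^ q) * gaussAbsMoment q := by
  have hw : gaussianReal 0 w = (gaussianReal 0 1).map (fun x => Real.sqrt w * x) := by
    rw [gaussianReal_map_const_mul, mul_zero, mul_one]
    congr 1
    ext
    simp [Real.sq_sqrt w.coe_nonneg]
  rw [hw, lintegral_map (measurable_ofReal_abs_rpow q) (measurable_const_mul _)]
  have hsw : 0 ≤ Real.sqrt w := Real.sqrt_nonneg _
  have h1 : ∀ x : ℝ, ENNReal.ofReal |Real.sqrt w * x| ^ q =
      ENNReal.ofReal (Real.sqrt w ^ q) * ENNReal.ofReal |x| ^ q := by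
    intro x
    rw [abs_mul, abs_of_nonneg hsw, ENNReal.ofReal_mul hsw, ENNReal.mul_rpow_of_nonneg _ _ hq,
      ENNReal.ofReal_rpow_of_nonneg hsw hq]
  simp_rw [h1]
  rw [lintegral_const_mul _ (measurable_ofReal_abs_rpow q)]
  rfl

/-- **`E|Σ_i c_i f_i|^q = ((Σ c_i²) v)^{q/2} M_q` under `N(0,v)^{⊗ι}`.** [folklore] -/
theorem lintegral_abs_linear_rpow_piGaussian {ι : Type} [Fintype ι] (v : ℝ≥0) (c : ι → ℝ)
    {q : ℝ} (hq : 0 ≤ q) :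
    ∫⁻ f, ENNReal.ofReal |∑ i, c i * f i| ^ q ∂(Measure.pi fun _ : ι => gaussianReal 0 v) =
      ENNReal.ofReal (Real.sqrt ((∑ i, c i ^ 2) * v) ^ q) * gaussAbsMoment q := by
  have hS : Measurable fun f : ι → ℝ => ∑ i, c i * f i :=
    Finset.measurable_sum _ fun i _ => (measurable_pi_apply i).const_mul _
  rw [← lintegral_map (measurable_ofReal_abs_rpow q) hS, map_linear_piGaussian,
    lintegral_abs_rpow_gaussianReal _ hq, Real.coe_toNNReal _ (by positivity)]

end AbsMoment

/-! ## 2. Linear functionals of the skeleton -/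

section Skeleton

variable (m : ℕ)

/-- **`E |Σ_j Ξ_j U_j|^q = (2^{-m} Σ_j U_j²)^{q/2} M_q`** under the skeleton Gaussian
(`Ξ_j = coordX m · j`, i.i.d. `N(0, 2^{-m})`). [folklore] -/
theorem lintegral_abs_linear_rpow_skelGauss (U : Fin (2 ^ m) ⊕ Fin (2 ^ m) → ℝ) {q : ℝ}
    (hq : 0 ≤ q) :
    ∫⁻ y, ENNReal.ofReal |∑ j, coordX m y j * U j| ^ q ∂(skelGauss m) =
      ENNReal.ofReal (Real.sqrt (((2 : ℝ) ^ m)⁻¹ * ∑ j, U j ^ 2) ^ q) * gaussAbsMoment q := by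
  have hpres := measurePreserving_sumPiEquivProdPi
    fun _ : Fin (2 ^ m) ⊕ Fin (2 ^ m) => gaussianReal 0 (skelVar m)
  have hΦ : Measurable fun y : PairSkeleton m => ENNReal.ofReal |∑ j, coordX m y j * U j| ^ q := by
    refine (measurable_ofReal_abs_rpow q).comp (Finset.measurable_sum _ fun j _ => ?_)
    refine Measurable.mul_const ?_ _
    cases j with
    | inl k => exact (measurable_pi_apply k).comp measurable_fst
    | inr k => exact (measurable_pi_apply k).comp measurable_snd
  have hcoord : ∀ (f : Fin (2 ^ m) ⊕ Fin (2 ^ m) → ℝ) (j : Fin (2 ^ m) ⊕ Fin (2 ^ m)),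
      coordX m (MeasurableEquiv.sumPiEquivProdPi (fun _ : Fin (2 ^ m) ⊕ Fin (2 ^ m) => ℝ) f) j =
        f j := by
    intro f j
    cases j <;> rfl
  rw [← hpres.lintegral_comp hΦ]
  simp_rw [hcoord, mul_comm _ (U _)]
  rw [lintegral_abs_linear_rpow_piGaussian _ _ hq, coe_skelVar, mul_comm (∑ i, U i ^ 2)]

/-- **The same along the driving path**: `E |Σ_j Ξ_j(W) U_j|^q = (2^{-m} Σ_j U_j²)^{q/2} M_q`
under the two-bath Wiener measure (part S `map_pairSkel_wienerPair`). [folklore] -/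
theorem lintegral_abs_linear_rpow_wienerPair (U : Fin (2 ^ m) ⊕ Fin (2 ^ m) → ℝ) {q : ℝ}
    (hq : 0 ≤ q) :
    ∫⁻ wp, ENNReal.ofReal |∑ j, coordX m (pairSkel m wp) j * U j| ^ q ∂wienerPair =
      ENNReal.ofReal (Real.sqrt (((2 : ℝ) ^ m)⁻¹ * ∑ j, U j ^ 2) ^ q) * gaussAbsMoment q := by
  have hΦ : Measurable fun y : PairSkeleton m => ENNReal.ofReal |∑ j, coordX m y j * U j| ^ q := by
    refine (measurable_ofReal_abs_rpow q).comp (Finset.measurable_sum _ fun j _ => ?_)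
    refine Measurable.mul_const ?_ _
    cases j with
    | inl k => exact (measurable_pi_apply k).comp measurable_fst
    | inr k => exact (measurable_pi_apply k).comp measurable_snd
  rw [← lintegral_abs_linear_rpow_skelGauss m U hq, ← map_pairSkel_wienerPair,
    lintegral_map hΦ (measurable_pairSkel m)]

/-- **Upper bound in (SWM) shape**: if `2^{-m} Σ_j U_j² ≤ ρ` then
`E |Σ_j Ξ_j(W) U_j|^q ≤ (M_q^{1/q} √ρ)^q` (as `ENNReal.ofReal`), for `q > 0`. [folklore] -/
theorem lintegral_abs_linear_rpow_wienerPair_le (U : Fin (2 ^ m) ⊕ Fin (2 ^ m) → ℝ) {q : ℝ}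
    (hq : 0 < q) {ρ : ℝ} (hρ : ((2 : ℝ) ^ m)⁻¹ * ∑ j, U j ^ 2 ≤ ρ) :
    ∫⁻ wp, ENNReal.ofReal |∑ j, coordX m (pairSkel m wp) j * U j| ^ q ∂wienerPair ≤
      ENNReal.ofReal (((gaussAbsMoment q).toReal ^ q⁻¹ * Real.sqrt ρ) ^ q) := by
  rw [lintegral_abs_linear_rpow_wienerPair m U hq.le]
  have hM : gaussAbsMoment q ≠ ∞ := (gaussAbsMoment_lt_top hq).ne
  have hMr : 0 ≤ (gaussAbsMoment q).toReal := ENNReal.toReal_nonneg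
  have hρ0 : 0 ≤ ρ := le_trans (by positivity) hρ
  have h1 : ENNReal.ofReal (Real.sqrt (((2 : ℝ) ^ m)⁻¹ * ∑ j, U j ^ 2) ^ q) * gaussAbsMoment q =
      ENNReal.ofReal (Real.sqrt (((2 : ℝ) ^ m)⁻¹ * ∑ j, U j ^ 2) ^ q *
        (gaussAbsMoment q).toReal) := by
    rw [ENNReal.ofReal_mul (by positivity), ENNReal.ofReal_toReal hM]
  rw [h1]
  refine ENNReal.ofReal_le_ofReal ?_
  rw [Real.mul_rpow (by positivity) (Real.sqrt_nonneg _), Real.rpow_inv_rpow hMr hq.ne', mul_comm]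
  exact mul_le_mul_of_nonneg_left
    (Real.rpow_le_rpow (Real.sqrt_nonneg _) (Real.sqrt_le_sqrt hρ) hq.le) hMr

end Skeleton

end Summit.AtomisticToContinuum.FouriersLaw.Theorems.ExtensiveSnapshotIrreversibility.EnergyWindow
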